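import Mathlib
import Summits.Ventures.PercRepro2.A3InactiveTyped
import Summits.Ventures.PercRepro2.DAD

/-!
# Typed Harris for two-copy counts: the powerset bridge and `pairCount_harris`
(blind cell PercRepro2, mine-c g15, 2026-08-25; `conjectures/MINE-C.md` §24, `proofs/MINEC-TB14BLOCK.md`)

The two-copy count `pairCount F z Φ` of `A3InactiveTyped` sums `Φ y (flipOn F y)` over the first
copies `y` agreeing with the pinning `z` off the free set `F`.  Writing `P = pinnedOpen F z` for the
pinned-open edges and `r ⊆ F` for the free edges open in the first copy, the admissible first copies
are exactly the configurations `ofSet (P ∪ r)` and the second copy is `ofSet (P ∪ (F ∖ r))`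
(`pairCount_eq_sum_powerset`, the bridge to the fibre vocabulary of `DAD.lean`).

Through the bridge, `DAD.fibreHarris` (Kleitman's inequality fibre by fibre) becomes **typed Harris
for two-copy counts** (`pairCount_harris`): for up-sets `A, B` of configurations,
`N(A, B) ≤ N(A ∩ B, Ω)` — the cross-copy count of two increasing events is at most their same-copy
count.  Specialised to cluster events (`pairCount_harris_iL`, `pairCount_harris_iH`): for a root `a`
and vertices `b, c`, `#{y : b ∈ C_y(a), c ∈ C_{ȳ}(a)} ≤ #{y : b ∈ C_y(a), c ∈ C_y(a)}` at every
profile.  This is the one-root input of the cut-vertex reduction of typed BHK 1.4 (`TB14CutCase1`).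
Own work; standard axioms.
-/

namespace Summit.Ventures.PercRepro2

namespace PairHarris

open CovForm A3InactiveTyped

/-! ## The powerset bridge -/

section Bridge

variable {E : Type*}

/-- The free edges open in the first copy `y`. -/
def freeOf (F : Finset E) (y : Config E) : Finset E := F.filter (fun e => y e = true)

/-- The red free set lies in `F`. -/
lemma freeOf_subset (F : Finset E) (y : Config E) : freeOf F y ⊆ F := Finset.filter_subset _ _

variable [DecidableEq E]

/-- The configuration whose open edges are exactly `X`. -/
def ofSet (X : Finset E) : Config E := fun e => decide (e ∈ X)

/-- `ofSet X` opens exactly the edges of `X`. -/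
@[simp] lemma ofSet_apply (X : Finset E) (e : E) : ofSet X e = decide (e ∈ X) := rfl

/-- `ofSet` is monotone. -/
lemma ofSet_mono {X Y : Finset E} (h : X ⊆ Y) : ofSet X ≤ ofSet Y := by
  intro e
  simp only [ofSet_apply]
  by_cases he : e ∈ X
  · simp [he, h he]
  · simp [he]

variable [Fintype E]

/-- The pinned-open edges of the profile `(F, z)`: the edges off `F` that `z` opens. -/
def pinnedOpen (F : Finset E) (z : Config E) : Finset E :=
  Finset.univ.filter (fun e => e ∉ F ∧ z e = true)

/-- Membership in the pinned-open set. -/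
lemma mem_pinnedOpen {F : Finset E} {z : Config E} {e : E} :
    e ∈ pinnedOpen F z ↔ e ∉ F ∧ z e = true := by
  simp [pinnedOpen]

/-- The pinned-open edges are off `F`. -/
lemma disjoint_pinnedOpen (F : Finset E) (z : Config E) : Disjoint (pinnedOpen F z) F := by
  rw [Finset.disjoint_left]
  intro e he
  exact (mem_pinnedOpen.1 he).1

/-- An admissible first copy is recovered from its red free set. -/
lemma ofSet_freeOf {F : Finset E} {z y : Config E} (hy : ∀ e, e ∉ F → y e = z e) :
    ofSet (pinnedOpen F z ∪ freeOf F y) = y := by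
  funext e
  simp only [ofSet_apply, Finset.mem_union, mem_pinnedOpen, freeOf, Finset.mem_filter]
  by_cases heF : e ∈ F
  · simp [heF]
  · simp [heF, hy e heF]

/-- The red free set of `ofSet (P ∪ r)` is `r`. -/
lemma freeOf_ofSet {F : Finset E} {z : Config E} {r : Finset E} (hr : r ⊆ F) :
    freeOf F (ofSet (pinnedOpen F z ∪ r)) = r := by
  ext e
  simp only [freeOf, Finset.mem_filter, ofSet_apply, Finset.mem_union, mem_pinnedOpen,
    decide_eq_true_eq]
  constructor
  · rintro ⟨heF, (⟨hnF, _⟩ | hr')⟩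
    · exact absurd heF hnF
    · exact hr'
  · intro he
    exact ⟨hr he, Or.inr he⟩

/-- `ofSet (P ∪ r)` is admissible. -/
lemma admissible_ofSet (F : Finset E) (z : Config E) {r : Finset E} (hr : r ⊆ F) :
    ∀ e, e ∉ F → ofSet (pinnedOpen F z ∪ r) e = z e := by
  intro e he
  have : e ∉ r := fun h => he (hr h)
  simp only [ofSet_apply, Finset.mem_union, mem_pinnedOpen]
  simp [he, this]

/-- The second copy of `ofSet (P ∪ r)` is `ofSet (P ∪ (F ∖ r))`. -/
lemma flipOn_ofSet (F : Finset E) (z : Config E) {r : Finset E} (hr : r ⊆ F) :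
    A3InactiveTyped.flipOn F (ofSet (pinnedOpen F z ∪ r)) = ofSet (pinnedOpen F z ∪ (F \ r)) := by
  funext e
  by_cases heF : e ∈ F
  · rw [A3InactiveTyped.flipOn_of_mem heF]
    simp only [ofSet_apply, Finset.mem_union, mem_pinnedOpen, Finset.mem_sdiff]
    by_cases her : e ∈ r <;> simp [heF, her]
  · rw [A3InactiveTyped.flipOn_of_notMem heF]
    have : e ∉ r := fun h => heF (hr h)
    simp only [ofSet_apply, Finset.mem_union, mem_pinnedOpen, Finset.mem_sdiff]
    simp [heF, this]

variable {R : Type*} [CommRing R]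

/-- **The bridge**: the two-copy count at the profile `(F, z)` is the sum over the red free sets
`r ⊆ F` of `Φ (ofSet (P ∪ r)) (ofSet (P ∪ (F ∖ r)))`, `P = pinnedOpen F z`. -/
theorem pairCount_eq_sum_powerset (F : Finset E) (z : Config E) (Φ : Config E → Config E → R) :
    pairCount F z Φ = ∑ r ∈ F.powerset,
      Φ (ofSet (pinnedOpen F z ∪ r)) (ofSet (pinnedOpen F z ∪ (F \ r))) := by
  unfold pairCount
  rw [← Finset.sum_filter]
  refine Finset.sum_nbij' (fun y => freeOf F y) (fun r => ofSet (pinnedOpen F z ∪ r))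
    ?_ ?_ ?_ ?_ ?_
  · intro y _
    exact Finset.mem_powerset.2 (freeOf_subset F y)
  · intro r hr
    rw [Finset.mem_filter]
    exact ⟨Finset.mem_univ _, admissible_ofSet F z (Finset.mem_powerset.1 hr)⟩
  · intro y hy
    exact ofSet_freeOf (Finset.mem_filter.1 hy).2
  · intro r hr
    exact freeOf_ofSet (Finset.mem_powerset.1 hr)
  · intro y hy
    have hy' := (Finset.mem_filter.1 hy).2
    rw [← flipOn_ofSet F z (freeOf_subset F y), ofSet_freeOf hy']

end Bridge

/-! ## Typed Harris -/

section Harris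

variable {E : Type*} [Fintype E] [DecidableEq E] {R : Type*} [Field R] [LinearOrder R]
  [IsStrictOrderedRing R]

/-- **Typed Harris for two-copy counts**: for up-sets `A, B` of configurations, at every profile
the cross-copy count `N(A, B)` is at most the same-copy count `N(A ∩ B, Ω)`. -/
theorem pairCount_harris (F : Finset E) (z : Config E) (A B : Set (Config E)) (hA : IsUpperSet A)
    (hB : IsUpperSet B) :
    pairCount F z (fun y w => A.indicator (1 : Config E → R) y * B.indicator 1 w) ≤
      pairCount F z (fun y _ => A.indicator (1 : Config E → R) y * B.indicator 1 y) := by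
  rw [pairCount_eq_sum_powerset, pairCount_eq_sum_powerset]
  let 𝒰 : Set (Finset E) := {X | ofSet X ∈ A}
  let 𝒱 : Set (Finset E) := {X | ofSet X ∈ B}
  have h𝒰 : IsUpperSet 𝒰 := fun X Y hXY hX => hA (ofSet_mono hXY) hX
  have h𝒱 : IsUpperSet 𝒱 := fun X Y hXY hX => hB (ofSet_mono hXY) hX
  have key := DAD.fibreHarris (R := R) F (pinnedOpen F z) (pinnedOpen F z)
    (disjoint_pinnedOpen F z) (disjoint_pinnedOpen F z) 𝒰 𝒱 h𝒰 h𝒱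
  have hl : ∀ r : Finset E, A.indicator (1 : Config E → R) (ofSet (pinnedOpen F z ∪ r)) *
      B.indicator 1 (ofSet (pinnedOpen F z ∪ (F \ r))) =
      𝒰.indicator (1 : Finset E → R) (pinnedOpen F z ∪ r) *
        𝒱.indicator 1 (pinnedOpen F z ∪ (F \ r)) := by
    intro r
    rfl
  have hr : ∀ r : Finset E, A.indicator (1 : Config E → R) (ofSet (pinnedOpen F z ∪ r)) *
      B.indicator 1 (ofSet (pinnedOpen F z ∪ r)) =
      (𝒰 ∩ 𝒱).indicator (1 : Finset E → R) (pinnedOpen F z ∪ pinnedOpen F z ∪ r) := by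
    intro r
    rw [Finset.union_self, Set.inter_indicator_one, Pi.mul_apply]
    rfl
  calc ∑ r ∈ F.powerset, A.indicator (1 : Config E → R) (ofSet (pinnedOpen F z ∪ r)) *
        B.indicator 1 (ofSet (pinnedOpen F z ∪ (F \ r)))
      = ∑ r ∈ F.powerset, 𝒰.indicator (1 : Finset E → R) (pinnedOpen F z ∪ r) *
          𝒱.indicator 1 (pinnedOpen F z ∪ (F \ r)) := Finset.sum_congr rfl fun r _ => hl r
    _ ≤ ∑ r ∈ F.powerset,
          (𝒰 ∩ 𝒱).indicator (1 : Finset E → R) (pinnedOpen F z ∪ pinnedOpen F z ∪ r) := key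
    _ = ∑ r ∈ F.powerset, A.indicator (1 : Config E → R) (ofSet (pinnedOpen F z ∪ r)) *
          B.indicator 1 (ofSet (pinnedOpen F z ∪ r)) := Finset.sum_congr rfl fun r _ => (hr r).symm

variable {V : Type*}

/-- Typed Harris for two cluster events of the root `a`: `#{b ∈ C_y(a), c ∈ C_{ȳ}(a)} ≤
#{b ∈ C_y(a), c ∈ C_y(a)}` at every profile (`iL` vocabulary). -/
theorem pairCount_harris_iL (ends : E → Sym2 V) (a b c : V) (F : Finset E) (z : Config E) :
    pairCount F z (fun y w => iL ends a b y * iL ends a c w : Config E → Config E → R) ≤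
      pairCount F z (fun y _ => iL ends a b y * iL ends a c y) :=
  pairCount_harris F z (connEvent ends a b) (connEvent ends a c) (isUpperSet_connEvent ends a b)
    (isUpperSet_connEvent ends a c)

/-- The same in the `iH` vocabulary (the root `a₂`). -/
theorem pairCount_harris_iH (ends : E → Sym2 V) (a b c : V) (F : Finset E) (z : Config E) :
    pairCount F z (fun y w => iH ends a b y * iH ends a c w : Config E → Config E → R) ≤
      pairCount F z (fun y _ => iH ends a b y * iH ends a c y) :=
  pairCount_harris F z (connEvent ends a b) (connEvent ends a c) (isUpperSet_connEvent ends a b)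
    (isUpperSet_connEvent ends a c)

end Harris

end PairHarris

end Summit.Ventures.PercRepro2
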